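import Literature.MathematicalPhysics.QuantumFieldTheory.Balaban1983to89.B9Thm34GConcrete
import Literature.MathematicalPhysics.QuantumFieldTheory.Balaban1983to89.B9Thm34GEntries342
import Literature.MathematicalPhysics.QuantumFieldTheory.Balaban1983to89.B6RandomWalkSection

/-!
# `Balaban1983to89.B9Thm34GCoarse` — [Balaban1985BackgroundPropagators] Theorem 3.4 p. 400, `G`-clause (existence of `G(U′U)` as the two-sided
# inverse of `Δ_a(U′U)` and ALL FOUR (3.42)-entries of Theorem 3.3 for it), concrete perturbation `U′ = e^{iηA}` with every `A`-dependent
# letter of Sect. B concrete (FILES 15/16), NOW WITH THE COARSE-LATTICE LETTERS IN THEIR OWN TYPING: `Q′, F′₂ :` sites → 𝔅, `Q′*, F′₂* :`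
# 𝔅 → sites ((3.19), (3.57), (3.59)), `C⁻¹ = (Q′G′²Q′*)⁻¹` and `C⁻¹(U′U)` on 𝔅 by Theorem 3.2's KERNEL bound (3.48), `C′(A)` on 𝔅 by (3.66), the
# resolvent identity (3.67) on 𝔅 — read on the sites through a section of the block map (FILE 17 `B6RandomWalkSection`), so that
# `P(U) = G′Q′*(Q′G′²Q′*)⁻¹Q′G′` of (3.25) appears as the GENUINE two-space word — FILE 18 of the Sect. B programme

statement-level skeleton of published theorems with citation tags; proofs where landed; nothing here is a claim about the Yang–Mills mass gap

DOCFIX (cell `lit-balaban`, seat r06 gen 15, 2026-08-22; p37 `CITELOC-SWEEP-B4B9.md` §2b page-numeral slips, text layer re-read): (3.19) is p. 393 [PDF 5] ((3.20)–(3.25) p. 394); (3.57) is p. 401 [PDF 13] ((3.58)–(3.65) p. 402, (3.65)bis–(3.68) p. 403) — the locators of (3.19), (3.19)/(3.25), (3.57)/(3.59) in this file corrected accordingly (4 place(s)); declarations, statements and proofs byte-identical to the tree copy of record (p315966).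

CITATION HEADER (lean-in-tree rule).  B9 = T. Bałaban, *Propagators for lattice gauge theories in a background field*, Commun. Math. Phys.
**99** (1985) 389–434 [Balaban1985BackgroundPropagators] (held `paper:balaban1985-cmp99-background-propagators`; journal page = PDF page + 388):
Thm 3.4 p. 400 («There exists a positive constant a₁ such that the operators G′(U), (Q′(U)G′²(U)Q′*(U))⁻¹, R(U), G(U) extend to configurations U′U
for α₁ ≦ a₁ as analytic functions of A. The extended operators satisfy all the inequalities of Theorems 3.1–3.3 correspondingly.»); (3.19) p. 393
(the averaging operators `Q′_j`), (3.21)/(3.25) p. 394 (`(Q′G′²Q′*)⁻¹`, `P(U) = G′Q′*(Q′G′²Q′*)⁻¹Q′G′`), Thm 3.2 (3.48) p. 398 («|(Q′(U)G′(U)²Q′*(U))⁻¹(y, y′)|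
≦ B₁(Lʲη)⁻⁴(L^{j′}η)^{−d}e^{−δ₁d(y,y′)} for y ∈ Λ_j, y′ ∈ Λ_{j′}»), (3.57) p. 401/(3.59) p. 402, (3.65)–(3.67) p. 403, (3.42) p. 397, Thm 3.3 p. 399, (3.82)–(3.86)
p. 407; the route pp. 400–407 as in FILES 15/16.  [4] = [Balaban1984PropagatorsII] Lemma 2.1 p. 234, (2.51)–(2.55) p. 232, (2.66) p. 234; [B11] =
[Balaban1985Variational] (135) p. 298.  Cell `lit-balaban`, seat r06 (B9 fold owner) gen 12, FILE 18; rows B9.Thm3.4 × B9.Thm3.2 × B9.Eq3.25 ×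
B9.Eq3.19 × B9.Eq3.66 × B9.Eq3.68 × B9.Eq3.85.

WHAT THIS FILE PROVES (one theorem; 0 `def`; 0 sorry; standard axioms).
* **`thm34_G_clause_coarseLetters`** — the hypotheses of FILE 16's `B9Thm34GEntries342.thm34_G_entries342_allConcrete` with the block of
  site-endomorphism letters `{Gp Qp Qps Qp' Qps' Fp₂ Fp₂s Cinv Cinv' Cp} (h357p h357ps hCC hQp hQps hFp hFps hCinv hCinv' hCp)` REPLACED by:
  `Gp` (with `h342_1/2/3` unchanged); a section `(rep : g.Site → S × ι) (hrep : ∀ y, blk (rep y).1 = y)` (every block contains a site); two-space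
  letters `{Qc Qc' Fc : (S × ι → ℝ) →ₗ[ℝ] (g.Site → ℝ)} {Qcs Qcs' Fcs : (g.Site → ℝ) →ₗ[ℝ] (S × ι → ℝ)}` with (3.57) `h357 : Qc' = Qc + Fc`,
  `h357s`, block-local majorants `hQc`/`hQcs` (`κ_Q`, (3.19)) and `hFc`/`hFcs` (`c_Fα₁`, (3.59)) as `HasMajorantHom` between the site carrier and 𝔅
  (identity block map); `{Linv Linv' Ccp : Module.End ℝ (g.Site → ℝ)}` with Theorem 3.2's KERNEL bounds `h348 : ∀ y y', |ker (vol g d) Linv y y'| ≦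
  B₁(Lʲη)^{−4}(L^{j′}η)^{−d}e^{−δ_G d}` for `C⁻¹(U)`, `h348'` (constant `B_c′`) for `C⁻¹(U′U)` — exactly the output shape of
  `B9Ineq366CPrime.inverse_satisfies_thm32_of_parts` —, the (3.66) majorant `h366 : Ccp ≺ κ_Cα₁(Lʲη)⁴e^{−δ_G d}` over the identity block map,
  and (3.67) `h367 : Linv' − Linv = −(Linv'·Ccp·Linv)` on 𝔅; `hΔG`/`hGΔ` and the conclusion written with the GENUINE word `Gp ∘ₗ Qcs ∘ₗ Linv ∘ₗ
  Qc ∘ₗ Gp` for `P(U)` and with `P′(A) = pPrime Gp (gPrimeExtEnd Gp (V′Gp)) (Qcs ∘ rep*) (Qcs' ∘ rep*) (rep_! Linv rep*) (rep_! Linv' rep*) (rep_! ∘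
  Qc) (rep_! ∘ Qc')`.  CONCLUSION: ∃ `G(U′U)`, two-sided inverse of the concrete `Δ_a(U′U)`, with EVERY left entry (`X·G(U) ≺ B₀Pe^{−δd} ⟹
  X·G(U′U) ≺ B₀c₁(α′)(1−κ′α₁c₁(α′))⁻¹Pe^{−(1−α′)ρd}`) and EVERY right entry (`G(U)·Y ≺ B₀Lʲη e^{−δd} ⟹ G(U′U)·Y ≺ B₀Λ_ρ²c₁(α′)(1−κ′α₁c₁)⁻¹
  Lʲη e^{−(1−3α′)ρd}`) of Theorem 3.3 — constants and smallness exactly FILES 15/16's.  PROOF: the site-model letters `rep_! ∘ Q′`, `Q′* ∘ rep*`,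
  `rep_! Linv rep*`, … satisfy FILE 15/16's hypotheses by `B6RandomWalkSection` (`hasMajorant_secExt_comp`, `hasMajorant_comp_secRes`,
  `hasMajorant_sites_of_ker` = (3.48) kernel form ⇒ block majorant, `hasMajorant_secConj`, `secConj_resolvent`, `secExt_comp_add`,
  `add_comp_secRes`), the word identity `G′(Q′*rep*)(rep_! C⁻¹ rep*)(rep_! Q′)G′ = G′Q′*C⁻¹Q′G′` (`rep* ∘ rep_! = id`), then FILE 15 (existence) and
  FILE 16 (entries).

HONEST SCOPE / NOT CLAIMED.  As FILES 15/16 (operator form; (3.43)–(3.47) not here; no kernel ↔ block identification on the SITE side; finite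
lattice); the remainder `P′(A)` is the one-space `pPrime` word of the letters read through `rep` (a two-space `pPrime` is not defined in the tree;
its words agree with the genuine ones on the range of `rep_!` by `B6RandomWalkSection.word_secConj`-type identities); inputs that remain letters:
Theorem 3.1 (3.42)₁₋₃ for `G′(U)`, Theorem 3.2 for `U` ((3.48) kernel form `h348`; (3.21) existence implicit in the letter `Linv`), the
(3.66)/(3.67) data for `C⁻¹(U′U)`, `C′(A)` on 𝔅 (`h348'`, `h366`, `h367` — concrete derivations: `B9Ineq366CPrime.inverse_satisfies_thm32_of_parts`,
`hasMajorant_cornerR_cPrime`, `eq365_cornerR`, through gen 6's `X ⊕ 𝔅` embedding; port = the remaining step of INTERFACES-r06 §21), `P₂` with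
(3.83)/(3.80), Theorem 3.3 for `G(U)`, structural/stencil/threshold hypotheses; no row head changes.

RELATED IN THE TREE, NOT DUPLICATED (searched 2026-08-22: `lean search 'coarseLetters|thm34_G_clause'` = ∅): FILES 15/16/17 USED BY NAME.
-/

noncomputable section

namespace Literature.MathematicalPhysics.QuantumFieldTheory.Balaban1983to89.B9Thm34GCoarse

open NormedSpace Complex
open Literature.MathematicalPhysics.QuantumFieldTheory.Balaban1983to89
open Literature.MathematicalPhysics.QuantumFieldTheory.Balaban1983to89.B6RandomWalk (HasMajorant hasMajorant_mono Triangle254 Ineq261)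
open Literature.MathematicalPhysics.QuantumFieldTheory.Balaban1983to89.B6RandomWalkHom (HasMajorantHom hasMajorantHom_mono hasMajorantHom_iff)
open Literature.MathematicalPhysics.QuantumFieldTheory.Balaban1983to89.B9Thm34Ext (toB6)
open Literature.MathematicalPhysics.QuantumFieldTheory.Balaban1983to89.B9Ineq347 (ScaleTransfer)
open Literature.MathematicalPhysics.QuantumFieldTheory.Balaban1983to89.B9Ineq366CPrime (hasMajorant_rate_mono)
open Literature.MathematicalPhysics.QuantumFieldTheory.Balaban1983to89.B9Eq386Neumann (vTotal vThree pTwo deltaA eq384_sub)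
open Literature.MathematicalPhysics.QuantumFieldTheory.Balaban1983to89.B9Ineq377POne (kappa377 kappa377_nonneg)
open Literature.MathematicalPhysics.QuantumFieldTheory.Balaban1983to89.B9Ineq385VG (kappa385 kappa385_nonneg gExt_leftEntry_of_386)
open Literature.MathematicalPhysics.QuantumFieldTheory.Balaban1983to89.B9Ineq386RightEntry (gExt_rightEntry_of_386L)
open Literature.MathematicalPhysics.QuantumFieldTheory.Balaban1983to89.B9Ineq386CommSum (ineq385_op_sum hasMajorant_GV_of_gradForm_comm_sum)
open Literature.MathematicalPhysics.QuantumFieldTheory.Balaban1983to89.B9Eq39Adjoint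
open Literature.MathematicalPhysics.QuantumFieldTheory.Balaban1983to89.B9Eq369Small (Through)
open Literature.MathematicalPhysics.QuantumFieldTheory.Balaban1983to89.B9Eq372Locality (stBonds)
open Literature.MathematicalPhysics.QuantumFieldTheory.Balaban1983to89.B9Eq352DivForm (tauF tauB)
open Literature.MathematicalPhysics.QuantumFieldTheory.Balaban1983to89.B9Eq352DivFormLetters
open Literature.MathematicalPhysics.QuantumFieldTheory.Balaban1983to89.B9Eq352GradLetters (diffLetter)
open Literature.MathematicalPhysics.QuantumFieldTheory.Balaban1983to89.B9Eq371GradLetters (bT bU zeroLetter V1Letter)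
open Literature.MathematicalPhysics.QuantumFieldTheory.Balaban1983to89.B9Eq375GradLetters (zeroLetter₂ V1Letter₂)
open Literature.MathematicalPhysics.QuantumFieldTheory.Balaban1983to89.B9Eq372RemLetters
open Literature.MathematicalPhysics.QuantumFieldTheory.Balaban1983to89.B9Eq382V3Letters
open Literature.MathematicalPhysics.QuantumFieldTheory.Balaban1983to89.B9Ineq385V3Concrete (cV385 cV0_nonneg cV385_nonneg)
open Literature.MathematicalPhysics.QuantumFieldTheory.Balaban1983to89.B9Eq373CurvComm (hasMajorant_comm_V₃_one)
open Literature.MathematicalPhysics.QuantumFieldTheory.Balaban1983to89.B9Ineq386V3Concrete (norm_plaqU_adjacent_of_through)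
open Literature.MathematicalPhysics.QuantumFieldTheory.Balaban1983to89.B9Eq376POneLetters
open Literature.MathematicalPhysics.QuantumFieldTheory.Balaban1983to89.B9Ineq377POneConcrete (ineq377_concreteE)
open Literature.MathematicalPhysics.QuantumFieldTheory.Balaban1983to89.B9Ineq349Hom (ineq349_hom)
open Literature.MathematicalPhysics.QuantumFieldTheory.Balaban1983to89.B9Ineq368PPrime (kappa349 kappa368)
open Literature.MathematicalPhysics.QuantumFieldTheory.Balaban1983to89.B9Ineq368PPrimeDs (kappa368Ds)
open Literature.MathematicalPhysics.QuantumFieldTheory.Balaban1983to89.B9Eq360Vprime (gPrimeExtEnd)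
open Literature.MathematicalPhysics.QuantumFieldTheory.Balaban1983to89.B9Eq360VprimeLetters (vPrimeConc cBConc cCConc)
open Literature.MathematicalPhysics.QuantumFieldTheory.Balaban1983to89.B9Ineq363Vprime (cVConc theta363 thetaL363)
open Literature.MathematicalPhysics.QuantumFieldTheory.Balaban1983to89.B9Ineq368Vprime (ineq368_op_conc ineq368_op_D_conc ineq368_op_Ds_conc
  ineq368_op_DDs_conc)
open Literature.MathematicalPhysics.QuantumFieldTheory.Balaban1983to89.B9Eq376DerivDict (hasMajorantHom_gradLin_comp hasMajorantHom_gradLin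
  hasMajorantHom_comp_divLin hasMajorantHom_divLin hasMajorant_gradLin_comp_comp_divLin)
open Literature.MathematicalPhysics.QuantumFieldTheory.Balaban1983to89.B9Thm34GConcrete (thm34_G_entries13_allConcrete)
open Literature.MathematicalPhysics.QuantumFieldTheory.Balaban1983to89.B9Thm34GEntries342 (thm34_G_entries342_allConcrete)
open Literature.MathematicalPhysics.QuantumFieldTheory.Balaban1983to89.B6RandomWalkSection
open Literature.MathematicalPhysics.QuantumFieldTheory.Balaban1983to89.B6RandomWalkHom (hasMajorantHom_zero)

section Assembly

variable {𝔸 : Type*} [NormedRing 𝔸] [NormedAlgebra ℂ 𝔸] [CompleteSpace 𝔸] {ι : Type} [Fintype ι]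
variable (b : Module.Basis ι ℝ 𝔸) {S : Type} {κ : Type} [Fintype κ] [LinearOrder κ]
variable (T : κ → Equiv.Perm S) (U : κ → S → 𝔸ˣ)
variable {g : B9.Geometry} [Fintype g.Site] {Rr : ℝ} {H : Prop}

/-- **THEOREM 3.4, `G`-CLAUSE, CONCRETE PERTURBATION, COARSE-LATTICE LETTERS IN THEIR OWN TYPING** — existence of `G(U′U)` as the two-sided
inverse of the concrete `Δ_a(U′U)` (FILE 15) with all four (3.42)-entries of Theorem 3.3 (FILE 16), the letters `Q′, Q′*, F′₂, F′₂*` typed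
between the site carrier and 𝔅, `C⁻¹`, `C⁻¹(U′U)` given by Theorem 3.2's kernel bound (3.48) on 𝔅, `C′(A)` by (3.66) on 𝔅, (3.67) on 𝔅, all read
on the sites through a section `rep` of the block map; `P(U) = G′Q′*C⁻¹Q′G′` the genuine two-space word.
[cite: Balaban1985BackgroundPropagators, Thm 3.4 p.400 + Thm 3.2 (3.48) p.398 + (3.19) p.393/(3.25) p.394 + (3.57) p.401/(3.59) p.402 + (3.66)–(3.67) p.403 + Thm 3.3 p.399 + (3.42) p.397 + (3.82)–(3.86) p.407 + (3.68) p.403 + (3.76)–(3.77) pp.405–406 + (3.37)/(3.35) p.396; Balaban1984PropagatorsII, Lemma 2.1 p.234 + (2.51)–(2.55) p.232 + (2.66) p.234; Balaban1985Variational, (135) p.298] -/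
theorem thm34_G_clause_coarseLetters [Fintype S] [DecidableEq S] [DecidableEq ι] [DecidableEq g.Site] (blk : S → g.Site) (d : ℕ)
    (δ₀ δ δP δG α β ρ α' ρ₁ α'' Λ Λρ Λρ₁ B₀ κQ BG B₁ Bc' κC cF Cq a₀ κP κP' κ₁ κ₂ α₁ C₀ d₀ M₂ : ℝ)
    (kQ kF : g.Site → S → 𝔸 →L[ℝ] 𝔸) (sQ sF : S → 𝔸 →L[ℝ] 𝔸) (cfun w : g.Site → ℝ)
    (hB₀ : 0 ≤ B₀) (hκQ : 0 ≤ κQ) (hBG : 0 ≤ BG) (hB₁ : 0 ≤ B₁) (hBc' : 0 ≤ Bc') (hκC : 0 ≤ κC) (hcF : 0 ≤ cF) (hCq : 0 ≤ Cq) (ha₀ : 0 ≤ a₀) (hκP' : 0 ≤ κP') (hκ₂ : 0 ≤ κ₂) (hα₁ : 0 ≤ α₁) (hC₀ : 0 ≤ C₀) (hΛ : 1 ≤ Λ) (hΛρ : 0 ≤ Λρ)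
    (hρ : 0 ≤ ρ) (hα : 0 ≤ α) (hβ : 0 ≤ β) (hδ₀ : 0 ≤ δ₀) (hδ : 0 ≤ δ) (hM₂ : 0 ≤ M₂) (hr : ρ + (α + β) * δ₀ ≤ δ)
    (hrP : δ + 2 * ((α + β) * δ₀) ≤ δP) (hrG : δP + (2 * α + β) * δ₀ ≤ δG)
    (hr1 : ρ₁ + (α + β) * δ₀ ≤ δG) (hα''1 : α'' ≤ 1) (hα''0 : 0 ≤ α'') (hρ₁ : 0 ≤ ρ₁) (hα''ρ : 0 ≤ (1 - α'') * ρ₁)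
    (hα''ρ2 : 0 ≤ (1 - 2 * α'') * ρ₁) (hα''ρ3 : 0 ≤ (1 - 3 * α'') * ρ₁) (hΛρ₁ : 0 ≤ Λρ₁)
    (hr368 : δP + 2 * ((2 * α + β) * δ₀) ≤ B9Ineq368Vprime.rateC α'' ρ₁)
    (hκP : κP = kappa349 κQ ((1 + Fintype.card κ) * BG) B₁ Λ (B6.c1 d δ₀ β)) (hα' : α' ≤ 1) (hα'ρ0 : 0 ≤ α' * ρ) (hα'ρ2 : 0 ≤ (1 - 2 * α') * ρ)
    (hκ₁ : κ₁ = kappa377 (4 * (1 + Fintype.card κ) * (M₂ * ∑ i, ‖b i‖) * Real.exp (δP * d₀)) κP κP' Λ (B6.c1 d δ₀ β) α₁)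
    (hdnn : ∀ a a' : g.Site, 0 ≤ g.dist a a') (htri : Triangle254 (toB6 g Rr H)) (hrefl : ∀ y : g.Site, g.dist y y = 0)
    (hsym : ∀ y y' : g.Site, g.dist y y' = g.dist y' y) (hlen : ∀ y : g.Site, 0 < g.len y)
    (h261 : Ineq261 d (toB6 g Rr H) δ₀ β) (h261' : Ineq261 d (toB6 g Rr H) ρ α') (h261'' : Ineq261 d (toB6 g Rr H) ρ₁ α'')
    (hT1 : ScaleTransfer g δ₀ α Λ (fun a => g.len a)) (hT2 : ScaleTransfer g δ₀ α Λ (fun a => g.len a ^ 2))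
    (hT1i : ScaleTransfer g δ₀ α Λ (fun a => (g.len a)⁻¹)) (hT2i : ScaleTransfer g δ₀ α Λ (fun a => (g.len a ^ 2)⁻¹))
    (hT4 : ScaleTransfer g δ₀ α Λ (fun a => (g.len a ^ 4)⁻¹))
    (hTρ : ScaleTransfer g ρ α' Λρ (fun a => g.len a))
    (hTρ₁ : ScaleTransfer g ρ₁ α'' Λρ₁ (fun a => g.len a))
    (hsmall385 : kappa385 B₀
        (cV385 (Fintype.card κ) α₁ C₀ (M₂ * (∑ i, ‖b i‖) * Real.exp (δ * d₀))
          + ∑ _k ∈ (Finset.univ : Finset (κ ⊕ κ)),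
            (10 + 8 * Fintype.card κ + (16 * Fintype.card κ + 12) * C₀) * (M₂ * (∑ i, ‖b i‖) * Real.exp (δ * d₀)))
        κ₁ κ₂ Λ (B6.c1 d δ₀ β) * α₁ * B6.c1 d ρ α' < 1)
    (hrepr : ∀ (v : 𝔸) (i : ι), |b.repr v i| ≤ M₂ * ‖v‖) (hη : 0 < g.eta) (hL : 1 ≤ g.L) (A : κ → S → 𝔸)
    (hT : ∀ (μ ν : κ) (x : S), T μ (T ν x) = T ν (T μ x))
    (hsmall : ∀ y : g.Site, g.eta * (α₁ * (g.len y)⁻¹) ≤ 1 / 4)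
    (hU1 : ∀ m z, ‖((U m z : 𝔸ˣ) : 𝔸)‖ ≤ 1 ∧ ‖(((U m z)⁻¹ : 𝔸ˣ) : 𝔸)‖ ≤ 1)
    -- (3.37) for the exponent field, blockwise, in the shapes files 1–10 read it
    (h337B : ∀ ν k x, ‖((g.eta : ℂ)⁻¹) • covDstar T U ν (A k) x‖ ≤ α₁ * (g.len (blk x) ^ 2)⁻¹)
    (h337F : ∀ μ ν x, ‖((g.eta : ℂ)⁻¹) • covD T U μ (A ν) x‖ ≤ α₁ * (g.len (blk x) ^ 2)⁻¹)
    (h337B' : ∀ μ ν x, ‖((g.eta : ℂ)⁻¹) • covDstar T U ν (A ν) (T μ x)‖ ≤ α₁ * (g.len (blk x) ^ 2)⁻¹)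
    (h337Bτ : ∀ μ x, ‖((g.eta : ℂ)⁻¹) • covDstar T U μ (tauB T U μ (A μ)) x‖ ≤ α₁ * (g.len (blk x) ^ 2)⁻¹)
    (h337FB : ∀ μ ν k x, ‖((g.eta : ℂ)⁻¹) • covD T U μ (A k) ((T ν).symm x)‖ ≤ α₁ * (g.len (blk x) ^ 2)⁻¹)
    (hA : ∀ k x, ‖A k x‖ ≤ α₁ * (g.len (blk x))⁻¹) (hAτB : ∀ ν k x, ‖tauB T U ν (A k) x‖ ≤ α₁ * (g.len (blk x))⁻¹)
    (hAτF : ∀ μ k x, ‖tauF T U μ (A k) x‖ ≤ α₁ * (g.len (blk x))⁻¹)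
    (hAFB : ∀ k μ ν x, ‖A k ((T ν).symm (T μ x))‖ ≤ α₁ * (g.len (blk x))⁻¹)
    (hAst : ∀ μ x m z, (m, z) ∈ stBonds T μ x → ‖A m z‖ ≤ α₁ * (g.len (blk x))⁻¹)
    (hAloc : ∀ μ x m z, (m, z) ∈ B9Eq375Locality.locBondsA T μ x → ‖A m z‖ ≤ α₁ * (g.len (blk x))⁻¹)
    (hdAst : ∀ μ x m n y, Through T μ x m n y →
      ‖covD T U m (A n) y‖ ≤ g.eta * (α₁ * ((g.len (blk x))⁻¹) ^ 2) ∧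
        ‖covD T U n (A m) y‖ ≤ g.eta * (α₁ * ((g.len (blk x))⁻¹) ^ 2))
    -- (3.35) on the plaquettes through each bond, at that bond's block scale
    (h35 : ∀ μ x m n y, Through T μ x m n y → ‖(plaqU T U m n y : 𝔸) - 1‖ ≤ C₀ * ((g.L ^ g.scale (blk x))⁻¹) ^ 2)
    -- stencil geometry
    (hd₀B : ∀ μ x, g.dist (blk x) (blk ((T μ).symm x)) ≤ d₀) (hd₀F : ∀ μ x, g.dist (blk x) (blk (T μ x)) ≤ d₀)
    (hd₀FB : ∀ μ ν x, g.dist (blk x) (blk ((T ν).symm (T μ x))) ≤ d₀)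
    (hd₀st : ∀ μ x (q : κ × S), q ∈ stBonds T μ x → g.dist (blk x) (blk q.2) ≤ d₀)
    (hd₀loc : ∀ μ x (q : κ × S), q ∈ B9Eq375Locality.locBondsA' T μ x → g.dist (blk x) (blk q.2) ≤ d₀)
    (hd₀0 : ∀ y : g.Site, g.dist y y ≤ d₀)
    -- Theorem 3.1 (3.42)₁,₂,₃ for `G′(U)` (site endomorphism `Gp`) with the DIRECTIONAL derivative letters (p. 398: the choice `∇`/`∇*` is
    -- conventional), at the rate `δ_G`
    {Gp : Module.End ℝ (S × ι → ℝ)}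
    (h342_1 : HasMajorant (g := toB6 g Rr H) (fun p : S × ι => blk p.1) Gp
      (fun a a' => BG * g.len a ^ 2 * Real.exp (-(δG * g.dist a a'))))
    (h342_2 : ∀ k : κ ⊕ κ, HasMajorant (g := toB6 g Rr H) (fun p : S × ι => blk p.1)
      (conj b (diffLetter T U ((g.eta : ℂ)⁻¹) k) * Gp) (fun a a' => BG * g.len a * Real.exp (-(δG * g.dist a a'))))
    (h342_3 : ∀ k : κ ⊕ κ, HasMajorant (g := toB6 g Rr H) (fun p : S × ι => blk p.1)
      (Gp * conj b (diffLetter T U ((g.eta : ℂ)⁻¹) k)) (fun a a' => BG * g.len a * Real.exp (-(δG * g.dist a a'))))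
    -- THE COARSE-LATTICE LETTERS IN THEIR OWN TYPING (carrier 𝔅 = `g.Site`, identity block map), read on the sites through a section `rep` of the
    -- block map (FILE 17 `B6RandomWalkSection`): `Q′`, `F′₂` : sites → 𝔅 and `Q′*`, `F′₂*` : 𝔅 → sites block-local ((3.19), (3.57), (3.59)),
    -- `C⁻¹ = (Q′G′²Q′*)⁻¹` and `C⁻¹(U′U)` by Theorem 3.2's KERNEL bound (3.48) (as in `B9Ineq366CPrime.inverse_satisfies_thm32_of_parts`),
    -- `C′(A)` by its (3.66) block majorant on 𝔅, and the resolvent identity (3.67) on 𝔅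
    (rep : g.Site → S × ι) (hrep : ∀ y : g.Site, blk (rep y).1 = y)
    {Qc Qc' Fc : (S × ι → ℝ) →ₗ[ℝ] (g.Site → ℝ)} {Qcs Qcs' Fcs : (g.Site → ℝ) →ₗ[ℝ] (S × ι → ℝ)}
    {Linv Linv' Ccp : Module.End ℝ (g.Site → ℝ)}
    (h357 : Qc' = Qc + Fc) (h357s : Qcs' = Qcs + Fcs) (h367 : Linv' - Linv = -(Linv' * Ccp * Linv))
    (hQc : HasMajorantHom (g := toB6 g Rr H) (fun p : S × ι => blk p.1) (fun y : g.Site => y) Qc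
      (fun a a' : g.Site => if a = a' then κQ else 0))
    (hQcs : HasMajorantHom (g := toB6 g Rr H) (fun y : g.Site => y) (fun p : S × ι => blk p.1) Qcs
      (fun a a' : g.Site => if a = a' then κQ else 0))
    (hFc : HasMajorantHom (g := toB6 g Rr H) (fun p : S × ι => blk p.1) (fun y : g.Site => y) Fc
      (fun a a' : g.Site => if a = a' then cF * α₁ else 0))
    (hFcs : HasMajorantHom (g := toB6 g Rr H) (fun y : g.Site => y) (fun p : S × ι => blk p.1) Fcs
      (fun a a' : g.Site => if a = a' then cF * α₁ else 0))
    (h348 : ∀ y y' : g.Site, |B9Thm34Inv.ker (B9Thm34Inv.vol g d) Linv y y'| ≤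
      B₁ * g.len y ^ (-(4 : ℝ)) * g.len y' ^ (-(d : ℝ)) * Real.exp (-(δG * g.dist y y')))
    (h348' : ∀ y y' : g.Site, |B9Thm34Inv.ker (B9Thm34Inv.vol g d) Linv' y y'| ≤
      Bc' * g.len y ^ (-(4 : ℝ)) * g.len y' ^ (-(d : ℝ)) * Real.exp (-(δG * g.dist y y')))
    (h366 : HasMajorant (g := toB6 g Rr H) (fun y : g.Site => y) Ccp
      (fun a a' => κC * α₁ * g.len a ^ 4 * Real.exp (-(δG * g.dist a a'))))
    -- the data of the CONCRETE `V′(A)` of (3.60) (`B9Eq360VprimeLetters.vPrimeConc`): averaging kernels and their sizes ((3.19), (3.59)), the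
    -- `a`-weights ((3.24)), and the two smallness conditions of `B9Ineq363Vprime` («for α₁ sufficiently small», p. 402)
    (hw : ∀ y, 0 ≤ w y) (hcard : ∀ y, ((B9Eq360Vprime.block blk y).card : ℝ) * w y ≤ 1)
    (hkQ : ∀ y x, blk x = y → ‖kQ y x‖ ≤ w y) (hkF : ∀ y x, blk x = y → ‖kF y x‖ ≤ Cq * α₁ * w y)
    (hsQ : ∀ x, ‖sQ x‖ ≤ 1) (hsF : ∀ x, ‖sF x‖ ≤ Cq * α₁) (hcfun : ∀ y, |cfun y| ≤ a₀ * (g.len y ^ 2)⁻¹)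
    (hθ : theta363 (Fintype.card κ) 1 α₁ a₀ Cq M₂ (∑ i, ‖b i‖) (Real.exp (δG * d₀)) BG Λ (B6.c1 d δ₀ β) *
      B6.c1 d ρ₁ α'' < 1)
    (hθL : thetaL363 (Fintype.card κ) 1 α₁ a₀ Cq M₂ (∑ i, ‖b i‖) (Real.exp (δG * d₀)) BG Λ (B6.c1 d δ₀ β) *
      B6.c1 d ρ₁ α'' < 1)
    -- the constant `κ_{P′}` of the (3.77)-step dominates the four explicit (3.68)-constants of `B9Ineq368Vprime`
    (hK1 : kappa368 κQ cF
        (kappa385 1 (cVConc (Fintype.card κ) 1 α₁ a₀ Cq M₂ (∑ i, ‖b i‖) (Real.exp (δG * d₀))) 0 0 Λ (B6.c1 d δ₀ β))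
        κC BG BG (BG * B6.c1 d ρ₁ α'' *
          (1 - theta363 (Fintype.card κ) 1 α₁ a₀ Cq M₂ (∑ i, ‖b i‖) (Real.exp (δG * d₀)) BG Λ (B6.c1 d δ₀ β) * B6.c1 d ρ₁ α'')⁻¹)
        B₁ Bc' Λ (B6.c1 d δ₀ β) α₁ ≤ κP')
    (hK3 : Fintype.card κ * kappa368Ds κQ cF
        (kappa385 BG (cVConc (Fintype.card κ) 1 α₁ a₀ Cq M₂ (∑ i, ‖b i‖) (Real.exp (δG * d₀))) 0 0 Λ (B6.c1 d δ₀ β))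
        κC BG BG BG (B6.c1 d ρ₁ α'' *
          (1 - theta363 (Fintype.card κ) 1 α₁ a₀ Cq M₂ (∑ i, ‖b i‖) (Real.exp (δG * d₀)) BG Λ (B6.c1 d δ₀ β) * B6.c1 d ρ₁ α'')⁻¹)
        (BG * Λρ₁ ^ 2 * B6.c1 d ρ₁ α'' *
          (1 - thetaL363 (Fintype.card κ) 1 α₁ a₀ Cq M₂ (∑ i, ‖b i‖) (Real.exp (δG * d₀)) BG Λ (B6.c1 d δ₀ β) * B6.c1 d ρ₁ α'')⁻¹)
        B₁ Bc' (cBConc (Fintype.card κ) M₂ (∑ i, ‖b i‖) (Real.exp (B9Ineq368Vprime.rateC α'' ρ₁ * d₀)))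
        (cCConc (Fintype.card κ) 1 α₁ a₀ Cq M₂ (∑ i, ‖b i‖) (Real.exp (B9Ineq368Vprime.rateC α'' ρ₁ * d₀))) Λ (B6.c1 d δ₀ β) α₁
        ≤ κP')
    -- the abstract data of (3.80), the inverse property for the concrete `DRD*` and Theorem 3.3 for G(U)
    {G P₂ Qs Qs' Q Q' a F₂ F₂s : Module.End ℝ ((κ × S) × ι → ℝ)}
    (h380 : Q' = Q + F₂) (h380s : Qs' = Qs + F₂s) (hP₂def : P₂ = pTwo Qs Q F₂ F₂s a)
    (hΔG : deltaA (conj b (lapDDLetter T ((g.eta : ℂ)⁻¹) U)) (conj b (dPrimeLetter T U g.eta))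
      (conjHom b (gradLin T ((g.eta : ℂ)⁻¹) U) ∘ₗ (1 - (Gp ∘ₗ Qcs ∘ₗ Linv ∘ₗ Qc ∘ₗ Gp)) ∘ₗ conjHom b (divLin T ((g.eta : ℂ)⁻¹) U)) Qs a Q * G = 1)
    (hGΔ : G * deltaA (conj b (lapDDLetter T ((g.eta : ℂ)⁻¹) U)) (conj b (dPrimeLetter T U g.eta))
      (conjHom b (gradLin T ((g.eta : ℂ)⁻¹) U) ∘ₗ (1 - (Gp ∘ₗ Qcs ∘ₗ Linv ∘ₗ Qc ∘ₗ Gp)) ∘ₗ conjHom b (divLin T ((g.eta : ℂ)⁻¹) U)) Qs a Q = 1)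
    (hP₂ : HasMajorant (g := toB6 g Rr H) (fun q : (κ × S) × ι => blk q.1.2) P₂
      (fun a a' => κ₂ * α₁ * (g.len a ^ 2)⁻¹ * Real.exp (-(δ * g.dist a a'))))
    (hG : HasMajorant (g := toB6 g Rr H) (fun q : (κ × S) × ι => blk q.1.2) G
      (fun a a' => B₀ * g.len a ^ 2 * Real.exp (-(δ * g.dist a a'))))
    (hDG : ∀ k : κ ⊕ κ, HasMajorant (g := toB6 g Rr H) (fun q : (κ × S) × ι => blk q.1.2)
      (conj b (diffLetter (bT T) (bU U) ((g.eta : ℂ)⁻¹) k) * G) (fun a a' => B₀ * g.len a * Real.exp (-(δ * g.dist a a'))))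
    (hGD : ∀ k : κ ⊕ κ, HasMajorant (g := toB6 g Rr H) (fun q : (κ × S) × ι => blk q.1.2)
      (G * conj b (diffLetter (bT T) (bU U) ((g.eta : ℂ)⁻¹) k)) (fun a a' => B₀ * g.len a * Real.exp (-(δ * g.dist a a')))) :
    ∃ GExt : Module.End ℝ ((κ × S) × ι → ℝ),
      deltaA (conj b (lapDDLetter T ((g.eta : ℂ)⁻¹) (prodCfg U g.eta A)))
          (conj b (dPrimeLetter T (prodCfg U g.eta A) g.eta))
          (conjHom b (gradLin T ((g.eta : ℂ)⁻¹) (prodCfg U g.eta A)) ∘ₗ (1 - ((Gp ∘ₗ Qcs ∘ₗ Linv ∘ₗ Qc ∘ₗ Gp) + (B9Eq360Vprime.pPrime Gp (gPrimeExtEnd Gp (conj b (vPrimeConc T U g.eta A blk kQ kF sQ sF cfun) * Gp)) (Qcs ∘ₗ secRes rep) (Qcs' ∘ₗ secRes rep) (secConj rep Linv) (secConj rep Linv') (secExt rep ∘ₗ Qc) (secExt rep ∘ₗ Qc'))))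
            ∘ₗ conjHom b (divLin T ((g.eta : ℂ)⁻¹) (prodCfg U g.eta A))) Qs' a Q' * GExt = 1 ∧
      GExt *
      deltaA (conj b (lapDDLetter T ((g.eta : ℂ)⁻¹) (prodCfg U g.eta A)))
          (conj b (dPrimeLetter T (prodCfg U g.eta A) g.eta))
          (conjHom b (gradLin T ((g.eta : ℂ)⁻¹) (prodCfg U g.eta A)) ∘ₗ (1 - ((Gp ∘ₗ Qcs ∘ₗ Linv ∘ₗ Qc ∘ₗ Gp) + (B9Eq360Vprime.pPrime Gp (gPrimeExtEnd Gp (conj b (vPrimeConc T U g.eta A blk kQ kF sQ sF cfun) * Gp)) (Qcs ∘ₗ secRes rep) (Qcs' ∘ₗ secRes rep) (secConj rep Linv) (secConj rep Linv') (secExt rep ∘ₗ Qc) (secExt rep ∘ₗ Qc'))))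
            ∘ₗ conjHom b (divLin T ((g.eta : ℂ)⁻¹) (prodCfg U g.eta A))) Qs' a Q' = 1 ∧
    (∀ (X : Module.End ℝ ((κ × S) × ι → ℝ)) (P : g.Site → ℝ), (∀ y, 0 ≤ P y) →
      HasMajorant (g := toB6 g Rr H) (fun q : (κ × S) × ι => blk q.1.2) (X * G)
        (fun a a' => B₀ * P a * Real.exp (-(δ * g.dist a a'))) →
      HasMajorant (g := toB6 g Rr H) (fun q : (κ × S) × ι => blk q.1.2) (X * GExt)
        (fun a a' => B₀ * B6.c1 d ρ α' *
          (1 - kappa385 B₀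
            (cV385 (Fintype.card κ) α₁ C₀ (M₂ * (∑ i, ‖b i‖) * Real.exp (δ * d₀))
              + ∑ _k ∈ (Finset.univ : Finset (κ ⊕ κ)),
                (10 + 8 * Fintype.card κ + (16 * Fintype.card κ + 12) * C₀) * (M₂ * (∑ i, ‖b i‖) * Real.exp (δ * d₀)))
            κ₁ κ₂ Λ (B6.c1 d δ₀ β) * α₁ * B6.c1 d ρ α')⁻¹ *
          P a * Real.exp (-((1 - α') * ρ * g.dist a a')))) ∧
    (∀ Y : Module.End ℝ ((κ × S) × ι → ℝ),
      HasMajorant (g := toB6 g Rr H) (fun q : (κ × S) × ι => blk q.1.2) (G * Y)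
        (fun a a' => B₀ * g.len a * Real.exp (-(δ * g.dist a a'))) →
      HasMajorant (g := toB6 g Rr H) (fun q : (κ × S) × ι => blk q.1.2) (GExt * Y)
        (fun a a' => B₀ * Λρ ^ 2 * B6.c1 d ρ α' *
          (1 - kappa385 B₀
            (cV385 (Fintype.card κ) α₁ C₀ (M₂ * (∑ i, ‖b i‖) * Real.exp (δ * d₀))
              + ∑ _k ∈ (Finset.univ : Finset (κ ⊕ κ)),
                (10 + 8 * Fintype.card κ + (16 * Fintype.card κ + 12) * C₀) * (M₂ * (∑ i, ‖b i‖) * Real.exp (δ * d₀)))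
            κ₁ κ₂ Λ (B6.c1 d δ₀ β) * α₁ * B6.c1 d ρ α')⁻¹ *
          g.len a * Real.exp (-((1 - 3 * α') * ρ * g.dist a a')))) := by
  -- the section is injective; its block-compatibility in the shape FILE 17 reads
  have hinj : Function.Injective rep := fun y₁ y₂ h => by rw [← hrep y₁, ← hrep y₂, h]
  have hrep' : ∀ y : g.Site, (fun p : S × ι => blk p.1) (rep y) = (fun y : g.Site => y) y := hrep
  have hKQ : ∀ a a' : g.Site, 0 ≤ (if a = a' then κQ else 0) := fun a a' => by
    split_ifs
    · exact hκQ
    · exact le_rfl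
  have hKF : ∀ a a' : g.Site, 0 ≤ (if a = a' then cF * α₁ else 0) := fun a a' => by
    split_ifs
    · exact mul_nonneg hcF hα₁
    · exact le_rfl
  -- the coarse-lattice letters read on the sites (FILE 17): the hypotheses `hQp … hCp`, `h357p`, `h357ps`, `hCC` of FILES 15/16
  have hQp : HasMajorant (g := toB6 g Rr H) (fun p : S × ι => blk p.1) (secExt rep ∘ₗ Qc)
      (fun a a' : g.Site => if a = a' then κQ else 0) :=
    hasMajorant_secExt_comp (g := toB6 g Rr H) (blkX := fun p : S × ι => blk p.1) (blkZ := fun y : g.Site => y) hrep' hKQ hQc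
  have hQps : HasMajorant (g := toB6 g Rr H) (fun p : S × ι => blk p.1) (Qcs ∘ₗ secRes rep)
      (fun a a' : g.Site => if a = a' then κQ else 0) :=
    hasMajorant_comp_secRes (g := toB6 g Rr H) (blkX := fun p : S × ι => blk p.1) (blkZ := fun y : g.Site => y) hrep' hQcs
  have hFp : HasMajorant (g := toB6 g Rr H) (fun p : S × ι => blk p.1) (secExt rep ∘ₗ Fc)
      (fun a a' : g.Site => if a = a' then cF * α₁ else 0) :=
    hasMajorant_secExt_comp (g := toB6 g Rr H) (blkX := fun p : S × ι => blk p.1) (blkZ := fun y : g.Site => y) hrep' hKF hFc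
  have hFps : HasMajorant (g := toB6 g Rr H) (fun p : S × ι => blk p.1) (Fcs ∘ₗ secRes rep)
      (fun a a' : g.Site => if a = a' then cF * α₁ else 0) :=
    hasMajorant_comp_secRes (g := toB6 g Rr H) (blkX := fun p : S × ι => blk p.1) (blkZ := fun y : g.Site => y) hrep' hFcs
  have h357p : secExt rep ∘ₗ Qc' = secExt rep ∘ₗ Qc + secExt rep ∘ₗ Fc := by rw [h357, secExt_comp_add]
  have h357ps : Qcs' ∘ₗ secRes rep = Qcs ∘ₗ secRes rep + Fcs ∘ₗ secRes rep := by rw [h357s, add_comp_secRes]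
  have hCC : secConj rep Linv' - secConj rep Linv = -(secConj rep Linv' * secConj rep Ccp * secConj rep Linv) :=
    secConj_resolvent hinj h367
  have hw4 : ∀ y : g.Site, g.len y ^ (-(4 : ℝ)) = (g.len y ^ 4)⁻¹ := fun y => by
    rw [Real.rpow_neg (hlen y).le, show (4 : ℝ) = ((4 : ℕ) : ℝ) by norm_num, Real.rpow_natCast]
  have hCinv : HasMajorant (g := toB6 g Rr H) (fun p : S × ι => blk p.1) (secConj rep Linv)
      (fun a a' => B₁ * (g.len a ^ 4)⁻¹ * Real.exp (-(δG * g.dist a a'))) := by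
    have h := hasMajorant_sites_of_ker (R := Rr) (H := H) (fun p : S × ι => blk p.1) hrep d hlen B₁ (fun y => g.len y ^ (-(4 : ℝ)))
      (fun y y' => Real.exp (-(δG * g.dist y y')))
      (fun y y' => mul_nonneg (mul_nonneg hB₁ (Real.rpow_nonneg (hlen y).le _)) (Real.exp_nonneg _)) h348
    exact hasMajorant_mono (g := toB6 g Rr H) _ h fun a a' => by rw [hw4 a]
  have hCinv' : HasMajorant (g := toB6 g Rr H) (fun p : S × ι => blk p.1) (secConj rep Linv')
      (fun a a' => Bc' * (g.len a ^ 4)⁻¹ * Real.exp (-(δG * g.dist a a'))) := by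
    have h := hasMajorant_sites_of_ker (R := Rr) (H := H) (fun p : S × ι => blk p.1) hrep d hlen Bc' (fun y => g.len y ^ (-(4 : ℝ)))
      (fun y y' => Real.exp (-(δG * g.dist y y')))
      (fun y y' => mul_nonneg (mul_nonneg hBc' (Real.rpow_nonneg (hlen y).le _)) (Real.exp_nonneg _)) h348'
    exact hasMajorant_mono (g := toB6 g Rr H) _ h fun a a' => by rw [hw4 a]
  have hCp : HasMajorant (g := toB6 g Rr H) (fun p : S × ι => blk p.1) (secConj rep Ccp)
      (fun a a' => κC * α₁ * g.len a ^ 4 * Real.exp (-(δG * g.dist a a'))) :=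
    hasMajorant_secConj (g := toB6 g Rr H) (blkX := fun p : S × ι => blk p.1) (blkZ := fun y : g.Site => y) hrep'
      (fun a a' => mul_nonneg (mul_nonneg (mul_nonneg hκC hα₁) (pow_nonneg (hlen a).le 4)) (Real.exp_nonneg _)) h366
  -- the word of `P(U)` through the section IS `G′Q′*C⁻¹Q′G′` (FILE 17 `word_secConj`, here pointwise for this bracketing)
  have hPw : (Gp ∘ₗ (Qcs ∘ₗ secRes rep) ∘ₗ secConj rep Linv ∘ₗ (secExt rep ∘ₗ Qc) ∘ₗ Gp) = (Gp ∘ₗ Qcs ∘ₗ Linv ∘ₗ Qc ∘ₗ Gp) :=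
    LinearMap.ext fun F => by simp only [LinearMap.comp_apply, secConj_def, secRes_secExt_apply hinj]
  have hΔG' : deltaA (conj b (lapDDLetter T ((g.eta : ℂ)⁻¹) U)) (conj b (dPrimeLetter T U g.eta))
      (conjHom b (gradLin T ((g.eta : ℂ)⁻¹) U) ∘ₗ (1 - (Gp ∘ₗ (Qcs ∘ₗ secRes rep) ∘ₗ secConj rep Linv ∘ₗ (secExt rep ∘ₗ Qc) ∘ₗ Gp)) ∘ₗ conjHom b (divLin T ((g.eta : ℂ)⁻¹) U)) Qs a Q * G = 1 := by
    rw [hPw]; exact hΔG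
  have hGΔ' : G * deltaA (conj b (lapDDLetter T ((g.eta : ℂ)⁻¹) U)) (conj b (dPrimeLetter T U g.eta))
      (conjHom b (gradLin T ((g.eta : ℂ)⁻¹) U) ∘ₗ (1 - (Gp ∘ₗ (Qcs ∘ₗ secRes rep) ∘ₗ secConj rep Linv ∘ₗ (secExt rep ∘ₗ Qc) ∘ₗ Gp)) ∘ₗ conjHom b (divLin T ((g.eta : ℂ)⁻¹) U)) Qs a Q = 1 := by
    rw [hPw]; exact hGΔ
  -- a dummy right letter for FILE 15's fourth conjunct (discarded; the universal right entries come from FILE 16)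
  have hGDs0 : HasMajorant (g := toB6 g Rr H) (fun q : (κ × S) × ι => blk q.1.2) (G * 0)
      (fun a a' => B₀ * g.len a * Real.exp (-(δ * g.dist a a'))) := by
    rw [mul_zero]
    exact hasMajorant_mono (g := toB6 g Rr H) _
      ((hasMajorantHom_iff (g := toB6 g Rr H) _ _ _).mp (hasMajorantHom_zero (g := toB6 g Rr H) _ _))
      fun a a' => mul_nonneg (mul_nonneg hB₀ (hlen a).le) (Real.exp_nonneg _)
  -- FILE 15: existence of the two-sided inverse; FILE 16: all its (3.42)-entries
  obtain ⟨GExt, hinvL, hinvR, -, -⟩ := thm34_G_entries13_allConcrete (Rr := Rr) (H := H) b T U blk d δ₀ δ δP δG α β ρ α' ρ₁ α'' Λ Λρ Λρ₁ B₀ κQ BG B₁ Bc' κC cF Cq a₀ κP κP' κ₁ κ₂ α₁ C₀ d₀ M₂ kQ kF sQ sF cfun w hB₀ hκQ hBG hB₁ hBc' hκC hcF hCq ha₀ hκP' hκ₂ hα₁ hC₀ hΛ hΛρ hρ hα hβ hδ₀ hδ hM₂ hr hrP hrG hr1 hα''1 hα''0 hρ₁ hα''ρ hα''ρ2 hα''ρ3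 hΛρ₁ hr368 hκP hα' hα'ρ0 hα'ρ2 hκ₁ hdnn htri hrefl hsym hlen h261 h261' h261'' hT1 hT2 hT1i hT2i hT4 hTρ hTρ₁ hsmall385 hrepr hη hL A hT hsmall hU1 h337B h337F h337B' h337Bτ h337FB hA hAτB hAτF hAFB hAst hAloc hdAst h35 hd₀B hd₀F hd₀FB hd₀st hd₀loc hd₀0 h342_1 h342_2 h342_3 h357p h357ps hCC hQp hQps hFp hFps hCinv hCinv' hCp hw hcard hkQ hkF hsQ hsF hcfun hθ hθL hK1 hK3 h380 h380s hP₂def hΔG' hGΔ' hP₂ hG hDG hGD hGDs0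
  obtain ⟨hleft, hright⟩ := thm34_G_entries342_allConcrete (Rr := Rr) (H := H) b T U blk d δ₀ δ δP δG α β ρ α' ρ₁ α'' Λ Λρ Λρ₁ B₀ κQ BG B₁ Bc' κC cF Cq a₀ κP κP' κ₁ κ₂ α₁ C₀ d₀ M₂ kQ kF sQ sF cfun w hB₀ hκQ hBG hB₁ hBc' hκC hcF hCq ha₀ hκP' hκ₂ hα₁ hC₀ hΛ hΛρ hρ hα hβ hδ₀ hδ hM₂ hr hrP hrG hr1 hα''1 hα''0 hρ₁ hα''ρ hα''ρ2 hα''ρ3 hΛρ₁ hr368 hκP hα' hα'ρ0 hα'ρ2 hκ₁ hdnn htri hrefl hsym hlen h261 h261' h261'' hT1 hT2 hT1i hT2i hT4 hTρ hTρ₁ hsmall385 hrepr hη hL A hT hsmall hU1 h337B h337F h337B' h337Bτ h337FB hA hAτB hAτF hAFB hAst hAloc hdAst h35 hd₀B hd₀F hd₀FB hd₀st hd₀loc hd₀0 h342_1 h342_2 h342_3 h357p h357ps hCC hQp hQps hFp hFps hCinv hCinv' hCp hw hcard hkQ hkF hsQ hsF hcfun hθ hθL hK1 hK3 h380 h380s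 hP₂def hΔG' hGΔ' hP₂ hG hDG hGD hinvL hinvR
  refine ⟨GExt, ?_, ?_, hleft, hright⟩
  · rw [← hPw]; exact hinvL
  · rw [← hPw]; exact hinvR

end Assembly

end Literature.MathematicalPhysics.QuantumFieldTheory.Balaban1983to89.B9Thm34GCoarse

end
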